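import Mathlib.Algebra.Order.BigOperators.Group.Finset
import Mathlib.Algebra.BigOperators.Ring.Finset
import Mathlib.Data.Real.Basic
import Mathlib.Tactic.GCongr
import Mathlib.Tactic.Linarith

/-!
# Weak linear-programming duality (the certificate step of the peeled LP)

Helper file for the crux `NoFoldBound` (stmt-CriticalPhenomena-8296) of the route `SAWDevelopingMap`
(sub-problem `SAWScalingLimit` of `CriticalPhenomena`), programme FLAT / PEELED LP of the lead seats
c9–c10 (`FLAT-FINITE.md`, `FLAT-LEAN-DESIGN.md` on the item), brick L0. The flat instance of the
returning-loop bound is certified by a DUAL SOLUTION of a finite linear programme: nonnegative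
unknowns `g` (exit masses) satisfy equality rows `A g = b` (Duminil-Copin–Smirnov identities,
reversal) and inequality rows `G g ≥ h` (inclusion–exclusion); multipliers `u` (free) and `w ≥ 0`
whose reduced costs dominate the objective, `c ≤ Aᵀu − Gᵀw` coordinatewise, bound the objective:
`c · g ≤ u · b − w · h`. This is the elementary weak-duality inequality (e.g. A. Schrijver, *Theory
of Linear and Integer Programming* (1986), §7.4, Cor. 7.1g), stated over `ℝ` with finite index types.

## Contents (namespace `Summit.CriticalPhenomena.SAWScalingLimit.Theorems.SAWDevelopingMapNoFoldBound.Peel`)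
* `weak_duality` — the inequality above;
* `weak_duality_eq` — the version with equality rows only.
-/

open scoped BigOperators

namespace Summit.CriticalPhenomena.SAWScalingLimit.Theorems.SAWDevelopingMapNoFoldBound.Peel

/-- **Weak LP duality (certificate form).** Nonnegative `g` with `A g = b`, `G g ≥ h`; multipliers
`u` and `w ≥ 0` with reduced costs `c_j ≤ Σ_e u_e A_{ej} − Σ_i w_i G_{ij}`; then
`Σ_j c_j g_j ≤ Σ_e u_e b_e − Σ_i w_i h_i`. -/
theorem weak_duality : ∀ {J E I : Type*} [Fintype J] [Fintype E] [Fintype I] (g : J → ℝ) (A : E → J → ℝ) (b : E → ℝ) (G : I → J → ℝ) (h : I → ℝ) (c : J → ℝ) (u : E → ℝ) (w : I → ℝ), (∀ j, 0 ≤ g j) → (∀ i, 0 ≤ w i) → (∀ e, ∑ j, A e j * g j = b e) → (∀ i, h i ≤ ∑ j, G i j * g j) → (∀ j, c j ≤ (∑ e, u e * A e j) - ∑ i, w i * G i j) → ∑ j, c j * g j ≤ (∑ e, u e * b e) - ∑ i, w i * h i := by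
  intro J E I _ _ _ g A b G h c u w hg hw heq hge hrc
  -- bound the objective coefficientwise by the reduced costs
  have h1 : ∑ j, c j * g j ≤ ∑ j, ((∑ e, u e * A e j) - ∑ i, w i * G i j) * g j :=
    Finset.sum_le_sum fun j _ => mul_le_mul_of_nonneg_right (hrc j) (hg j)
  -- exchange the order of summation
  have h2 : ∑ j, ((∑ e, u e * A e j) - ∑ i, w i * G i j) * g j =
      (∑ e, u e * ∑ j, A e j * g j) - ∑ i, w i * ∑ j, G i j * g j := by
    simp only [sub_mul, Finset.sum_sub_distrib, Finset.sum_mul, Finset.mul_sum]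
    rw [Finset.sum_comm (s := Finset.univ) (t := Finset.univ) (f := fun j e => u e * A e j * g j),
      Finset.sum_comm (s := Finset.univ) (t := Finset.univ) (f := fun j i => w i * G i j * g j)]
    simp only [mul_assoc]
  -- use the rows
  have h3 : (∑ e, u e * ∑ j, A e j * g j) = ∑ e, u e * b e :=
    Finset.sum_congr rfl fun e _ => by rw [heq e]
  have h4 : ∑ i, w i * h i ≤ ∑ i, w i * ∑ j, G i j * g j :=
    Finset.sum_le_sum fun i _ => mul_le_mul_of_nonneg_left (hge i) (hw i)
  linarith [h1, h2, h3, h4]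

/-- Weak duality with equality rows only: `A g = b`, `c ≤ Aᵀ u` coordinatewise, `g ≥ 0` ⟹
`c · g ≤ u · b`. -/
theorem weak_duality_eq : ∀ {J E : Type*} [Fintype J] [Fintype E] (g : J → ℝ) (A : E → J → ℝ) (b : E → ℝ) (c : J → ℝ) (u : E → ℝ), (∀ j, 0 ≤ g j) → (∀ e, ∑ j, A e j * g j = b e) → (∀ j, c j ≤ ∑ e, u e * A e j) → ∑ j, c j * g j ≤ ∑ e, u e * b e := by
  intro J E _ _ g A b c u hg heq hrc
  have key := weak_duality (I := PEmpty.{1}) g A b (fun _ _ => 0) (fun _ => 0) c u (fun _ => 0) hg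
    (fun _ => le_rfl) heq (fun _ => by simp) (fun j => by simpa using hrc j)
  simpa using key

end Summit.CriticalPhenomena.SAWScalingLimit.Theorems.SAWDevelopingMapNoFoldBound.Peel
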